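import Literature.NumberTheory.Automorphic.Liu2021.LemD1AsPrintedIndexedNonVacuityDetLineDecision
import Literature.NumberTheory.Automorphic.UnitaryIsotropicCharactersDet
import Literature.NumberTheory.Automorphic.UnitaryRankThreeDiagonal
import Literature.NumberTheory.Automorphic.UnitaryGroupNonsplitPlace
import Literature.NumberTheory.QuadraticForms.HermitianLocalIsotropy
import Literature.NumberTheory.QuadraticForms.LandherrHermitianMatricesDiagonalize
import HarnessLib

/-!
# [Liu2021, App. D Lemma D.1 (3)] bookkeeping — EVERY rank `N ≥ 3`: NO CARRIER CHARACTER AT ALL where no det-line carrier exists;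
# THE CHARACTER DECISION at every finite place (`SU(V)(F_v) ≤ ker` of every character, Dieudonné II §5, general rank)

Reproduction ∕ bookkeeping (Literature, THEOREMS ONLY: no definition, no record, no named fact, no `sorry`; nothing is
asserted about Liu's oscillator representations or about the tree's constructed local Weil carriers).

✔ `…NonVacuityCharacterDecision` settled the END's rank `N = 3` with the tree's rank-3 engine ✔ `UnitaryRankThree*` and named
the gap «ranks `N ≥ 4` need the general Dieudonné theorem».  The general-rank engine is now in the tree:
✔ `Automorphic/UnitaryIsotropicCharactersDet` (`UnitaryIsotropic.apply_eq_one_of_det_eq_one'`: for a field with `2 ≠ 0`, an involution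
`σ` with `σ θ₀ = −θ₀ ≠ 0`, and ANY non-degenerate `σ`-hermitian `J` of ANY finite size admitting an isotropic vector, every homomorphism
`unitaryGroupOfForm σ J →* A` to a commutative group kills `{det = 1}`, [Dieudonne1971GroupesClassiques, Chap. II §5]).  THIS FILE is the
rank-`N` edition of ✔ `…CharacterDecision` §1–§3 on the place model `S = LemD1OfPlace.standingData` (`N ≥ 3`, so that `V ⊗ F_v` is isotropic
at every non-split place — ✔ `QuadraticForms/HermitianLocalIsotropy`, Jacobson ∕ O'Meara 63:19):

* §1 **`apply_eq_one_of_det_eq_one_of_diagonal`** — ANY quadratic `E/F`, `J = diagonal d` (`c dᵢ = dᵢ ≠ 0`), rank `N ≥ 3`, NON-SPLIT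
  `w ∣ v`: every `Ψ : U(V)(F_v) →* ℂˣ` kills `{g : det g = 1}`.
* §2 **`apply_eq_one_of_det_eq_one_of_isCMField`** — the CM rows (`L` CM, `F = L⁺`), ANY hermitian non-degenerate `J_N` over `L`,
  `N ≥ 3`, every non-split place (Landherr congruence to a diagonal form, transport ✔ `UnitaryRankThree.apply_eq_one_of_det_eq_one_of_formCongr`).
* §1 ∕ §3 **THE CHARACTER DECISION, rank `N ≥ 3`**: at a place of the conjunction «`c • w = w` ∧ `Odd N` ∧ `v_w(N) = 1` ∧
  (`e(w|v) ≠ 1` ∨ `gcd(N, q_v + 1) = 1`)» (✔ `…DetLineDecision.forall_exists_pow_eq_iff`: exactly the places where `E_v¹ = (E_v¹)^N`)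
  EVERY character of `U(V)(F_v)` trivial on the centre is TRIVIAL (**`eq_one_of_forall_scalar_eq_one_…`**), two characters with
  the same central character are EQUAL (**`eq_of_forall_scalar_eq_…`**), and at EVERY finite place
  **`exists_character_trivial_on_center_iff_…`**: «∃ Ψ, `Ψ ∘ S.scalar = 1`, `Ψ ≠ 1`» ⟺ ¬(that conjunction) (✔ `…DetLineDecision` for «⟸»).

What this does NOT give: rank `N = 2` (anisotropic binary forms exist at non-split places; and for isotropic binary forms the engine
applies but isotropy is not automatic); carriers of dimension `> 1`; the rows' OWN carriers `𝓢.omegaLoc v`; Lem. D.1 itself.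
HC_CM is NOT proved.

Cell pub-hodgecm2 (COR-CM), audit class of the END rows `hD1''` ∕ `hD3`; seat prover-pub-hodgecm2-b10.

References: [Liu2021] Y. Liu, *Fourier–Jacobi cycles and arithmetic relative trace formula*, Camb. J. Math. 9 (2021) =
arXiv:2102.11518, App. D §D.1 (l. 5213–5221), Lemma D.1 (3) (l. 5233); [Dieudonne1971GroupesClassiques] J. Dieudonné, *La géométrie
des groupes classiques*, 3e éd. (1971), Chap. II §§4–5; [Jacobson1940HermitianForms] N. Jacobson, Bull. AMS 46 (1940), §3 (1)(a);
[Landherr1936HermitianForms] W. Landherr, Abh. Math. Sem. Hamburg 11 (1936); [NeukirchANT1999] Ch. II §5 Prop. (5.3).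
-/

noncomputable section

open scoped Matrix MatrixGroups
open NumberField IsDedekindDomain
open Literature.RepresentationTheory
open Literature.RepresentationTheory.Liu2021 (OscillatorStandingData)
open Literature.NumberTheory.GaloisRepresentations (HeckeCharacter)
open Literature.NumberTheory.QuadraticForms (HermitianLocal.exists_isotropic_localRing_diagonal)

namespace Literature.NumberTheory.Automorphic.Liu2021.LemD1IndexedNonVacuityCharacterDecisionAllRanks

open UnitaryGroup

/-! ## §0 Transport of `SU ≤ ker` along an equality of subgroups -/

/-- If `S = T` as subgroups and every hom on `T` kills the elements satisfying `P`, so does every hom on `S`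
(copy of the private lemma of ✔ `…CharacterDecision`). [folklore] -/
private theorem kills_of_eq {G A : Type*} [Group G] [CommGroup A] {S T : Subgroup G} (e : S = T) (P : G → Prop)
    (hT : ∀ (θ' : ↥T →* A) (y : ↥T), P y.1 → θ' y = 1) (θ : ↥S →* A) (x : ↥S) (hx : P x.1) : θ x = 1 := by
  subst e
  exact hT θ x hx

/-! ## §1 ANY quadratic `E/F`, DIAGONAL `J` of rank `N ≥ 3`, NON-SPLIT place: every character of `U(V)(F_v)` kills `{det = 1}` -/

section Diagonal

variable {F : Type} (E : Type) [Field F] [NumberField F] [Field E] [NumberField E] [Algebra F E]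
  [Algebra.IsQuadraticExtension F E] (v : HeightOneSpectrum (𝓞 F)) (c : E ≃ₐ[F] E)
  {δ : E} (hcδ : c δ = -δ) (hδ : δ ≠ 0) {N : ℕ} (hN : 2 ≤ N) (hN3 : 3 ≤ N)
  (d : Fin N → E) (hJh : ((Matrix.diagonal d).map c)ᵀ = Matrix.diagonal d) (hJdet : (Matrix.diagonal d).det ≠ 0)

omit [NumberField F] [Algebra.IsQuadraticExtension F E] in
include hcδ hδ in
/-- `c ≠ 1` (`c δ = −δ ≠ δ`); copy of the siblings' private lemma. [folklore] -/
private theorem hc_of_delta : c ≠ 1 := by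
  rintro rfl
  rw [AlgEquiv.one_apply] at hcδ
  have h2 : (2 : E) * δ = 0 := by linear_combination hcδ
  exact hδ ((mul_eq_zero.mp h2).resolve_left two_ne_zero)

omit [NumberField F] [NumberField E] [Algebra.IsQuadraticExtension F E] in
include hJh in
/-- the diagonal entries of a hermitian diagonal matrix are `c`-fixed. [folklore] -/
private theorem apply_diag_eq (i : Fin N) : c (d i) = d i := by
  have h := congrFun (congrFun hJh i) i
  rwa [Matrix.transpose_apply, Matrix.map_apply, Matrix.diagonal_apply_eq] at h

omit [NumberField F] [NumberField E] [Algebra.IsQuadraticExtension F E] [Algebra F E] in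
include hJdet in
/-- the diagonal entries of a non-degenerate diagonal matrix are non-zero. [folklore] -/
private theorem diag_ne_zero (i : Fin N) : d i ≠ 0 := by
  rw [Matrix.det_diagonal] at hJdet
  exact (Finset.prod_ne_zero_iff.1 hJdet) i (Finset.mem_univ i)

include hcδ hJh hJdet hN3 in
/-- **Rank `N ≥ 3`, diagonal `J`, NON-SPLIT place: every character of `U(V)(F_v)` kills the determinant-one subgroup `SU(V)(F_v)`.**
At a non-split `v` the ring `E_v = E ⊗_F F_v` is a FIELD (✔ `LocalRing.isField_of_smul_eq`) with the involution `c ⊗ 1`, the form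
`J ⊗ 1 = diagonal(dᵢ ⊗ 1)` is isotropic there (rank `≥ 3`, ✔ `HermitianLocal.exists_isotropic_localRing_diagonal`), so the general-rank
engine ✔ `UnitaryIsotropic.apply_eq_one_of_det_eq_one'` applies to `UnitaryGroup.«local» E c N J v`, which has the same members as
`S.U` (✔ `LemD1OfPlace.mem_U_iff`). [cite: Dieudonne1971GroupesClassiques, Chap. II §5] [cite: Jacobson1940HermitianForms, §3 (1)(a)]
[cite: Liu2021, App. D §D.1 Step 3 (l. 5221)] -/
theorem apply_eq_one_of_det_eq_one_of_diagonal (w : PlacesOver E v) (hw : c • w.1 = w.1)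
    (Ψ : (LemD1OfPlace.standingData E v c N (Matrix.diagonal d) hcδ hδ hN hJh hJdet).U →* ℂˣ)
    (g : (LemD1OfPlace.standingData E v c N (Matrix.diagonal d) hcδ hδ hN hJh hJdet).U)
    (hg : Matrix.GeneralLinearGroup.det (g : GL (Fin N) (LocalRing E v)) = 1) : Ψ g = 1 := by
  classical
  have hc : c ≠ 1 := hc_of_delta E c hcδ hδ
  have hd : ∀ i, c (d i) = d i := apply_diag_eq E c d hJh
  have hd0 : ∀ i, d i ≠ 0 := diag_ne_zero E d hJdet
  letI : Field (LocalRing E v) := (LocalRing.isField_of_smul_eq c hc w hw).toField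
  have hσ : ∀ x, conjLocal E c v (conjLocal E c v x) = x := LemD1OfPlace.conjLocal_conjLocal_apply E v c hcδ hδ
  have hθ : conjLocal E c v (algebraMap E (LocalRing E v) δ) = -algebraMap E (LocalRing E v) δ := by
    rw [conjLocal_algebraMap, hcδ, map_neg]
  have hθ0 : algebraMap E (LocalRing E v) δ ≠ 0 := (_root_.map_ne_zero _).2 hδ
  have h2 : (2 : LocalRing E v) ≠ 0 := by
    rw [← map_ofNat (algebraMap E (LocalRing E v)) 2]
    exact (_root_.map_ne_zero _).2 two_ne_zero
  -- `S.U` is the tree's local unitary group of the form `J ⊗ 1 = diagonal (dᵢ ⊗ 1)`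
  have hEq : (LemD1OfPlace.standingData E v c N (Matrix.diagonal d) hcδ hδ hN hJh hJdet).U =
      unitaryGroupOfForm (conjLocal E c v) ((adelicForm E N (Matrix.diagonal d)).map (adeleToLocal E v)) :=
    Subgroup.ext fun x => LemD1OfPlace.mem_U_iff E v c N (Matrix.diagonal d) hcδ hδ hN hJh hJdet x
  have hM : (adelicForm E N (Matrix.diagonal d)).map (adeleToLocal E v) =
      Matrix.diagonal (fun i => algebraMap E (LocalRing E v) (d i)) := by
    rw [LemD1OfPlace.localGram_eq, Matrix.diagonal_map (map_zero _)]
  -- the local diagonal form is hermitian, non-degenerate and isotropic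
  have hJh' : ((Matrix.diagonal (fun i => algebraMap E (LocalRing E v) (d i))).map (conjLocal E c v)).transpose =
      Matrix.diagonal (fun i => algebraMap E (LocalRing E v) (d i)) := by
    rw [Matrix.diagonal_map (map_zero _), Matrix.diagonal_transpose]
    congr 1
    funext i
    rw [conjLocal_algebraMap, hd]
  have hJdet' : (Matrix.diagonal (fun i => algebraMap E (LocalRing E v) (d i))).det ≠ 0 := by
    rw [Matrix.det_diagonal]
    exact Finset.prod_ne_zero_iff.2 fun i _ => (_root_.map_ne_zero _).2 (hd0 i)
  obtain ⟨x, hx0, hxx⟩ := HermitianLocal.exists_isotropic_localRing_diagonal E c hc v hN3 hd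
  rw [Matrix.diagonal_map (map_zero _)] at hxx
  refine kills_of_eq hEq (fun y => ((y : GL (Fin N) (LocalRing E v)) : Matrix (Fin N) (Fin N) (LocalRing E v)).det = 1)
    ?_ Ψ g ?_
  · intro θ' y hy
    exact UnitaryIsotropic.apply_eq_one_of_det_eq_one' (σ := conjLocal E c v) hσ hθ hθ0 h2 _
      (Matrix.diagonal (fun i => algebraMap E (LocalRing E v) (d i))) hM hJh' hJdet' ⟨x, hx0, hxx⟩ θ' y hy
  · have h := congrArg (fun u : (LocalRing E v)ˣ => (u : LocalRing E v)) hg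
    simpa only [Matrix.GeneralLinearGroup.val_det_apply, Units.val_one] using h

include hcδ hJh hJdet hN3 in
/-- **Rank `N ≥ 3`, diagonal `J`, THE PLACES OF THE CONJUNCTION: every character of `U(V)(F_v)` trivial on the centre is TRIVIAL** —
at a non-split `w ∣ v` with `Odd N`, `v_w(N) = 1`, which is ramified over `v` or has `gcd(N, q_v + 1) = 1`: `E_v¹ = (E_v¹)^N`
(✔ `…DetLineDecision.forall_exists_pow_eq_iff`) and every character kills `SU(V)(F_v)` (above), so
✔ `…DetLineDecision.eq_one_of_forall_det_eq_one_of_forall_exists_pow_eq` concludes: NO one-dimensional carrier with trivial central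
character at all. [cite: Dieudonne1971GroupesClassiques, Chap. II §5] [cite: Liu2021, App. D §D.1 Step 3 (l. 5221) and Lemma D.1 (3) (l. 5233)]
[cite: NeukirchANT1999, Ch. II §5 Prop. (5.3)] -/
theorem eq_one_of_forall_scalar_eq_one_of_diagonal (w : PlacesOver E v)
    (hconj : c • w.1 = w.1 ∧ Odd N ∧ Valued.v ((N : w.1.adicCompletion E)) = 1 ∧
      (v.asIdeal.ramificationIdx' w.1.asIdeal ≠ 1 ∨ Nat.Coprime N (Nat.card (𝓞 F ⧸ v.asIdeal) + 1)))
    (Ψ : (LemD1OfPlace.standingData E v c N (Matrix.diagonal d) hcδ hδ hN hJh hJdet).U →* ℂˣ)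
    (hcen : ∀ z : (LemD1OfPlace.standingData E v c N (Matrix.diagonal d) hcδ hδ hN hJh hJdet).normOne,
      Ψ ((LemD1OfPlace.standingData E v c N (Matrix.diagonal d) hcδ hδ hN hJh hJdet).scalar z) = 1) :
    Ψ = 1 :=
  LemD1IndexedNonVacuityDetLineDecision.eq_one_of_forall_det_eq_one_of_forall_exists_pow_eq E v c hcδ hδ N (Matrix.diagonal d)
    hN hJh hJdet
    ((LemD1IndexedNonVacuityDetLineDecision.forall_exists_pow_eq_iff E v c hcδ hδ N (Matrix.diagonal d) hN hJh hJdet w).2 hconj)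
    Ψ (fun g hg => apply_eq_one_of_det_eq_one_of_diagonal E v c hcδ hδ hN hN3 d hJh hJdet w hconj.1 Ψ g hg) hcen

include hcδ hJh hJdet hN3 in
/-- **… hence two characters of `U(V)(F_v)` with the SAME central character are EQUAL there** (apply the previous theorem to
`Ψ₁ Ψ₂⁻¹`): no two-member model with LINE carriers, equal `χ`-labels and non-isomorphic carriers exists at these places for ANY rank `N ≥ 3`.
[cite: Dieudonne1971GroupesClassiques, Chap. II §5] [cite: Liu2021, App. D Lemma D.1 (3) (l. 5233)] -/
theorem eq_of_forall_scalar_eq_of_diagonal (w : PlacesOver E v)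
    (hconj : c • w.1 = w.1 ∧ Odd N ∧ Valued.v ((N : w.1.adicCompletion E)) = 1 ∧
      (v.asIdeal.ramificationIdx' w.1.asIdeal ≠ 1 ∨ Nat.Coprime N (Nat.card (𝓞 F ⧸ v.asIdeal) + 1)))
    (Ψ₁ Ψ₂ : (LemD1OfPlace.standingData E v c N (Matrix.diagonal d) hcδ hδ hN hJh hJdet).U →* ℂˣ)
    (h12 : ∀ z : (LemD1OfPlace.standingData E v c N (Matrix.diagonal d) hcδ hδ hN hJh hJdet).normOne,
      Ψ₁ ((LemD1OfPlace.standingData E v c N (Matrix.diagonal d) hcδ hδ hN hJh hJdet).scalar z) =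
        Ψ₂ ((LemD1OfPlace.standingData E v c N (Matrix.diagonal d) hcδ hδ hN hJh hJdet).scalar z)) :
    Ψ₁ = Ψ₂ := by
  have key := eq_one_of_forall_scalar_eq_one_of_diagonal E v c hcδ hδ hN hN3 d hJh hJdet w hconj (Ψ₁ * Ψ₂⁻¹) fun z => by
    rw [MonoidHom.mul_apply, MonoidHom.inv_apply, h12, mul_inv_cancel]
  exact mul_inv_eq_one.1 key

include hcδ hJh hJdet hN3 in
/-- **THE CHARACTER DECISION, rank `N ≥ 3`, diagonal `J`, EVERY finite place**: a character of `U(V)(F_v)` trivial on the centre `E_v¹` and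
non-trivial EXISTS ⟺ NOT (`c • w = w` ∧ `Odd N` ∧ `v_w(N) = 1` ∧ (`e(w|v) ≠ 1` ∨ `gcd(N, q_v + 1) = 1`)) — «⟸» by the det-line carriers of
✔ `…DetLineDecision.exists_detLine_carrier_of_not`, «⟹» by the previous theorem. [cite: Dieudonne1971GroupesClassiques, Chap. II §5]
[cite: Liu2021, App. D §D.1 Step 3 (l. 5221) and Lemma D.1 (3) (l. 5233)] -/
theorem exists_character_trivial_on_center_iff_of_diagonal (w : PlacesOver E v) :
    (∃ Ψ : (LemD1OfPlace.standingData E v c N (Matrix.diagonal d) hcδ hδ hN hJh hJdet).U →* ℂˣ,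
        (∀ z : (LemD1OfPlace.standingData E v c N (Matrix.diagonal d) hcδ hδ hN hJh hJdet).normOne,
          Ψ ((LemD1OfPlace.standingData E v c N (Matrix.diagonal d) hcδ hδ hN hJh hJdet).scalar z) = 1) ∧
        Ψ ≠ 1) ↔
      ¬ (c • w.1 = w.1 ∧ Odd N ∧ Valued.v ((N : w.1.adicCompletion E)) = 1 ∧
        (v.asIdeal.ramificationIdx' w.1.asIdeal ≠ 1 ∨ Nat.Coprime N (Nat.card (𝓞 F ⧸ v.asIdeal) + 1))) := by
  constructor
  · rintro ⟨Ψ, hcen, hne⟩ hconj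
    exact hne (eq_one_of_forall_scalar_eq_one_of_diagonal E v c hcδ hδ hN hN3 d hJh hJdet w hconj Ψ hcen)
  · intro h
    obtain ⟨Ψ, θ, -, hcen, -, ⟨g₀, hg₀⟩, -, -⟩ :=
      LemD1IndexedNonVacuityDetLineDecision.exists_detLine_carrier_of_not E v c hcδ hδ N (Matrix.diagonal d) hN hJh hJdet w h
    exact ⟨Ψ, hcen, fun h1 => hg₀ (by rw [h1, MonoidHom.one_apply])⟩

end Diagonal

/-! ## §2–§3 The CM rows: ANY hermitian `J_N` over `L` (Landherr congruence), every finite place of `L⁺`, rank `N ≥ 3` -/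

section CM

open Literature.NumberTheory.GelbartRogawski1991.UnitaryDualPair (imagUnit complexConj_imagUnit imagUnit_ne_zero)
open Literature.NumberTheory.QuadraticForms (Landherr.conjTranspose Landherr.conjTranspose_apply Landherr.exists_congr_diagonal)

variable (L : Type) [Field L] [NumberField L] [IsCMField L]

local notation3 "cc" => (IsCMField.complexConj L)
local notation3 "L⁺" => (↥(maximalRealSubfield L))

variable (v : HeightOneSpectrum (𝓞 (maximalRealSubfield L))) {N : ℕ} (hN : 2 ≤ N) (hN3 : 3 ≤ N)
  (J : Matrix (Fin N) (Fin N) L) (hJh : (J.map (IsCMField.complexConj L))ᵀ = J) (hJdet : J.det ≠ 0)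

include hN3 in
/-- **CM rows, ANY hermitian `J_N` (`N ≥ 3`), NON-SPLIT place: every character of `U(V)(L⁺_v)` kills `SU(V)(L⁺_v)`.**  Landherr's
congruence `ᵗḠ J G = diag d` over `L` (✔ `Landherr.exists_congr_diagonal`), read in the field `L ⊗ L⁺_v` (✔ `LocalRing.isField_of_smul_eq`),
transports (✔ `UnitaryRankThree.apply_eq_one_of_det_eq_one_of_formCongr`, any size) the general-rank engine on the diagonal form
(✔ `UnitaryIsotropic.apply_eq_one_of_det_eq_one`, isotropy ✔ `HermitianLocal.exists_isotropic_localRing_diagonal`) to `S.U`.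
[cite: Dieudonne1971GroupesClassiques, Chap. II §5] [cite: Landherr1936HermitianForms] [cite: Jacobson1940HermitianForms, §3 (1)(a)]
[cite: Liu2021, App. D §D.1 Step 3 (l. 5221)] -/
theorem apply_eq_one_of_det_eq_one_of_isCMField (w : PlacesOver L v) (hw : cc • w.1 = w.1)
    (Ψ : (LemD1OfPlace.standingData L v cc N J (complexConj_imagUnit L) (imagUnit_ne_zero L) hN hJh hJdet).U →* ℂˣ)
    (g : (LemD1OfPlace.standingData L v cc N J (complexConj_imagUnit L) (imagUnit_ne_zero L) hN hJh hJdet).U)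
    (hg : Matrix.GeneralLinearGroup.det (g : GL (Fin N) (LocalRing L v)) = 1) : Ψ g = 1 := by
  classical
  have hc : cc ≠ 1 := IsCMField.complexConj_ne_one L
  have hσ : ∀ x, conjLocal L cc v (conjLocal L cc v x) = x :=
    LemD1OfPlace.conjLocal_conjLocal_apply L v cc (complexConj_imagUnit L) (imagUnit_ne_zero L)
  have hθ : conjLocal L cc v (algebraMap L (LocalRing L v) (imagUnit L)) = -algebraMap L (LocalRing L v) (imagUnit L) := by
    rw [conjLocal_algebraMap, complexConj_imagUnit L, map_neg]
  have hθ0 : algebraMap L (LocalRing L v) (imagUnit L) ≠ 0 := (_root_.map_ne_zero _).2 (imagUnit_ne_zero L)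
  have h2 : (2 : LocalRing L v) ≠ 0 := by
    rw [← map_ofNat (algebraMap L (LocalRing L v)) 2]
    exact (_root_.map_ne_zero _).2 two_ne_zero
  have hcomp : ∀ y : L, conjLocal L cc v (algebraMap L (LocalRing L v) y) = algebraMap L (LocalRing L v) (IsCMField.complexConj L y) :=
    fun y => conjLocal_algebraMap cc v y
  -- Landherr's congruence over `L`
  have hJh' : Landherr.conjTranspose L J = J := by
    change (Jᵀ).map (IsCMField.complexConj L) = J
    rw [Matrix.transpose_map]
    exact hJh
  obtain ⟨G, hG, d, hd, hd0, hcong⟩ := Landherr.exists_congr_diagonal L J hJh' hJdet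
  -- read in `K = L ⊗ L⁺_v`
  have hGφ : IsUnit (G.map (algebraMap L (LocalRing L v))) := by
    rw [Matrix.isUnit_iff_isUnit_det, ← RingHom.mapMatrix_apply, ← RingHom.map_det]
    exact hG.map _
  let T : GL (Fin N) (LocalRing L v) := hGφ.unit
  have hT : T.1 = G.map (algebraMap L (LocalRing L v)) := hGφ.unit_spec
  have hM : (adelicForm L N J).map (adeleToLocal L v) = J.map (algebraMap L (LocalRing L v)) :=
    LemD1OfPlace.localGram_eq L v N J
  have hA : (T.1.map (conjLocal L cc v))ᵀ = (Landherr.conjTranspose L G).map (algebraMap L (LocalRing L v)) := by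
    rw [hT]
    ext i j
    simp only [Matrix.transpose_apply, Matrix.map_apply, Landherr.conjTranspose_apply, hcomp]
  have hcongr : formCongr (conjLocal L cc v) T ((adelicForm L N J).map (adeleToLocal L v)) =
      Matrix.diagonal (fun i => algebraMap L (LocalRing L v) (d i)) := by
    change (T.1.map (conjLocal L cc v))ᵀ * _ * T.1 = _
    rw [hA, hM, hT, ← Matrix.map_mul, ← Matrix.map_mul, hcong, Matrix.diagonal_map (map_zero _)]
  -- `S.U` is the tree's local unitary group of `J ⊗ 1`
  have hEq : (LemD1OfPlace.standingData L v cc N J (complexConj_imagUnit L) (imagUnit_ne_zero L) hN hJh hJdet).U =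
      unitaryGroupOfForm (conjLocal L cc v) ((adelicForm L N J).map (adeleToLocal L v)) :=
    Subgroup.ext fun x => LemD1OfPlace.mem_U_iff L v cc N J (complexConj_imagUnit L) (imagUnit_ne_zero L) hN hJh hJdet x
  -- the local diagonal form is hermitian, non-degenerate and isotropic (in the FIELD `L ⊗ L⁺_v`)
  obtain ⟨x, hx0, hxx⟩ := HermitianLocal.exists_isotropic_localRing_diagonal L cc hc v hN3 hd
  rw [Matrix.diagonal_map (map_zero _)] at hxx
  letI : Field (LocalRing L v) := (LocalRing.isField_of_smul_eq cc hc w hw).toField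
  have hdJh : ((Matrix.diagonal (fun i => algebraMap L (LocalRing L v) (d i))).map (conjLocal L cc v)).transpose =
      Matrix.diagonal (fun i => algebraMap L (LocalRing L v) (d i)) := by
    rw [Matrix.diagonal_map (map_zero _), Matrix.diagonal_transpose]
    congr 1
    funext i
    rw [hcomp, hd]
  have hdJdet : (Matrix.diagonal (fun i => algebraMap L (LocalRing L v) (d i))).det ≠ 0 := by
    rw [Matrix.det_diagonal]
    exact Finset.prod_ne_zero_iff.2 fun i _ => (_root_.map_ne_zero _).2 (hd0 i)
  refine kills_of_eq hEq (fun y => ((y : GL (Fin N) (LocalRing L v)) : Matrix (Fin N) (Fin N) (LocalRing L v)).det = 1) ?_ Ψ g ?_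
  · intro θ' y hy
    refine UnitaryRankThree.apply_eq_one_of_det_eq_one_of_formCongr T _ _ hcongr (fun χ' g' h' => ?_) θ' y hy
    exact UnitaryIsotropic.apply_eq_one_of_det_eq_one (σ := conjLocal L cc v) hσ hθ hθ0 h2
      (Matrix.diagonal (fun i => algebraMap L (LocalRing L v) (d i))) hdJh hdJdet ⟨x, hx0, hxx⟩ χ' g' h'
  · have h := congrArg (fun u : (LocalRing L v)ˣ => (u : LocalRing L v)) hg
    simpa only [Matrix.GeneralLinearGroup.val_det_apply, Units.val_one] using h

include hN3 in
/-- **CM rows, rank `N ≥ 3`, THE PLACES OF THE CONJUNCTION: every character of `U(V)(L⁺_v)` trivial on the centre is TRIVIAL**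
(ANY hermitian `J_N`): at a non-split `w` of `L` with `Odd N`, `v_w(N) = 1`, ramified over `L⁺` or with `gcd(N, q_v + 1) = 1`, there is NO
one-dimensional carrier with trivial central character at all. [cite: Dieudonne1971GroupesClassiques, Chap. II §5]
[cite: Liu2021, App. D Lemma D.1 (3) (l. 5233)] [cite: NeukirchANT1999, Ch. II §5 Prop. (5.3)] -/
theorem eq_one_of_forall_scalar_eq_one_of_isCMField (w : PlacesOver L v)
    (hconj : cc • w.1 = w.1 ∧ Odd N ∧ Valued.v ((N : w.1.adicCompletion L)) = 1 ∧
      (v.asIdeal.ramificationIdx' w.1.asIdeal ≠ 1 ∨ Nat.Coprime N (Nat.card (𝓞 L⁺ ⧸ v.asIdeal) + 1)))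
    (Ψ : (LemD1OfPlace.standingData L v cc N J (complexConj_imagUnit L) (imagUnit_ne_zero L) hN hJh hJdet).U →* ℂˣ)
    (hcen : ∀ z : (LemD1OfPlace.standingData L v cc N J (complexConj_imagUnit L) (imagUnit_ne_zero L) hN hJh hJdet).normOne,
      Ψ ((LemD1OfPlace.standingData L v cc N J (complexConj_imagUnit L) (imagUnit_ne_zero L) hN hJh hJdet).scalar z) = 1) :
    Ψ = 1 :=
  LemD1IndexedNonVacuityDetLineDecision.eq_one_of_forall_det_eq_one_of_forall_exists_pow_eq L v cc (complexConj_imagUnit L)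
    (imagUnit_ne_zero L) N J hN hJh hJdet
    ((LemD1IndexedNonVacuityDetLineDecision.forall_exists_pow_eq_iff L v cc (complexConj_imagUnit L) (imagUnit_ne_zero L) N J
      hN hJh hJdet w).2 hconj)
    Ψ (fun g hg => apply_eq_one_of_det_eq_one_of_isCMField L v hN hN3 J hJh hJdet w hconj.1 Ψ g hg) hcen

include hN3 in
/-- **CM rows, rank `N ≥ 3`: two characters of `U(V)(L⁺_v)` with the same central character are EQUAL at the places of the
conjunction** — no `μ`-alone ∕ `ε`-alone two-member model with ANY line carriers exists there. [cite: Dieudonne1971GroupesClassiques, Chap. II §5]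
[cite: Liu2021, App. D Lemma D.1 (3) (l. 5233)] -/
theorem eq_of_forall_scalar_eq_of_isCMField (w : PlacesOver L v)
    (hconj : cc • w.1 = w.1 ∧ Odd N ∧ Valued.v ((N : w.1.adicCompletion L)) = 1 ∧
      (v.asIdeal.ramificationIdx' w.1.asIdeal ≠ 1 ∨ Nat.Coprime N (Nat.card (𝓞 L⁺ ⧸ v.asIdeal) + 1)))
    (Ψ₁ Ψ₂ : (LemD1OfPlace.standingData L v cc N J (complexConj_imagUnit L) (imagUnit_ne_zero L) hN hJh hJdet).U →* ℂˣ)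
    (h12 : ∀ z : (LemD1OfPlace.standingData L v cc N J (complexConj_imagUnit L) (imagUnit_ne_zero L) hN hJh hJdet).normOne,
      Ψ₁ ((LemD1OfPlace.standingData L v cc N J (complexConj_imagUnit L) (imagUnit_ne_zero L) hN hJh hJdet).scalar z) =
        Ψ₂ ((LemD1OfPlace.standingData L v cc N J (complexConj_imagUnit L) (imagUnit_ne_zero L) hN hJh hJdet).scalar z)) :
    Ψ₁ = Ψ₂ := by
  have key := eq_one_of_forall_scalar_eq_one_of_isCMField L v hN hN3 J hJh hJdet w hconj (Ψ₁ * Ψ₂⁻¹) fun z => by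
    rw [MonoidHom.mul_apply, MonoidHom.inv_apply, h12, mul_inv_cancel]
  exact mul_inv_eq_one.1 key

include hN3 in
/-- **THE CHARACTER DECISION FOR EVERY RANK `N ≥ 3`** (ANY CM field `L`, ANY hermitian non-degenerate `J_N`, EVERY finite place `w ∣ v` of `L`):
a character of `U(V)(L⁺_v)` trivial on the centre and non-trivial EXISTS ⟺ NOT (`\bar w = w` ∧ `Odd N` ∧ `v_w(N) = 1` ∧ (`e(w|v) ≠ 1` ∨
`gcd(N, q_v + 1) = 1`)) — and then a det-line one exists (✔ `…DetLineDecision`).  The lineage's det-line picture IS the full one-dimensional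
picture at every rank `N ≥ 3`. [cite: Dieudonne1971GroupesClassiques, Chap. II §5] [cite: Liu2021, App. D §D.1 Step 3 (l. 5221) and Lemma D.1 (3) (l. 5233)] -/
theorem exists_character_trivial_on_center_iff_of_isCMField (w : PlacesOver L v) :
    (∃ Ψ : (LemD1OfPlace.standingData L v cc N J (complexConj_imagUnit L) (imagUnit_ne_zero L) hN hJh hJdet).U →* ℂˣ,
        (∀ z : (LemD1OfPlace.standingData L v cc N J (complexConj_imagUnit L) (imagUnit_ne_zero L) hN hJh hJdet).normOne,
          Ψ ((LemD1OfPlace.standingData L v cc N J (complexConj_imagUnit L) (imagUnit_ne_zero L) hN hJh hJdet).scalar z) = 1) ∧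
        Ψ ≠ 1) ↔
      ¬ (cc • w.1 = w.1 ∧ Odd N ∧ Valued.v ((N : w.1.adicCompletion L)) = 1 ∧
        (v.asIdeal.ramificationIdx' w.1.asIdeal ≠ 1 ∨ Nat.Coprime N (Nat.card (𝓞 L⁺ ⧸ v.asIdeal) + 1))) := by
  constructor
  · rintro ⟨Ψ, hcen, hne⟩ hconj
    exact hne (eq_one_of_forall_scalar_eq_one_of_isCMField L v hN hN3 J hJh hJdet w hconj Ψ hcen)
  · intro h
    obtain ⟨Ψ, θ, -, hcen, -, ⟨g₀, hg₀⟩, -, -⟩ :=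
      LemD1IndexedNonVacuityDetLineDecision.exists_detLine_carrier_of_not L v cc (complexConj_imagUnit L) (imagUnit_ne_zero L) N J
        hN hJh hJdet w h
    exact ⟨Ψ, hcen, fun h1 => hg₀ (by rw [h1, MonoidHom.one_apply])⟩

end CM

end Literature.NumberTheory.Automorphic.Liu2021.LemD1IndexedNonVacuityCharacterDecisionAllRanks
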